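import Literature.Topology.PlaneTopology.OsgoodFatDomain
import HarnessLib

/-!
# The fat example domain (line `germ-label-transport`, crux `stmt-CriticalPhenomena-0698`)

Stub `stub_fatDomain` of the fat-germ one-shot-surgery skeleton refuting
`Summit.CriticalPhenomena.CardyFormulaZ2.Theses.CardyRotToConf.CardyRotToConfR2SymmetryUpgrade`:
the EXAMPLE firing domain of the surgery. From an Osgood arc `γ` (a continuous arc, injective on
`[0, 1]`, from `0` to `1` in the closed unit square, with trace of positive planar Lebesgue
measure — the hypothesis; such arcs exist, `Literature.Topology.PlaneTopology.exists_osgoodArc`)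
one gets a Dobrushin domain `(D; 0, -2i)`: the inside of the fat Jordan loop
`Literature.Topology.PlaneTopology.OsgoodDomain.fatLoop γ` (`OsgoodFatLoop.lean`), packaged as
`OsgoodDomain.fatDomain` (`OsgoodFatDomain.lean`). Its six listed properties are proved there and
in `OsgoodFatLoopVolume.lean`: both boundary branches at the mark `0` have positive area in every
parameter neighbourhood (they contain similar copies `2⁻ⁿ • (3/4 + γ/4)` of the arc and their
mirror images), the lower half-disc of radius `1/2` at `0` and the vertical chord to `-2i` lie in
`D` (local two-sidedness of the Jordan loop at a point of the segment `1 → -2i`), the real points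
`± 2⁻ⁿ · 5/8` are on the loop, and so are points `2⁻ⁿ • (3/4 + γ s / 4)` with `im γ s > 0`.
-/

noncomputable section

open MeasureTheory

namespace Summit.CriticalPhenomena.CardyFormulaZ2.Theorems.CardyRotToConfR2SymmetryUpgrade

open Literature.Probability.RandomPlanarGeometry Literature.Topology.PlaneTopology
  Literature.Topology.PlaneTopology.OsgoodDomain

/-- **The fat example domain.** From an Osgood arc (continuous, injective on `[0, 1]`, from `0`
to `1` in the unit square, trace of positive area) one builds a Dobrushin domain `(D; 0, -2i)`
whose two boundary branches at `0` have positive area in every parameter neighbourhood of the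
mark, which contains the lower half-disc of radius `1/2` at `0`, misses real points `±x` and
some point of the open upper half-plane arbitrarily close to `0`, and whose vertical chord from
`0` runs inside `D` down to `-2i` (the inside of the fat loop of the arc,
`OsgoodDomain.fatDomain`). [folklore] -/
theorem stub_fatDomain :
    (∃ γ : ℝ → ℂ, Continuous γ ∧ Set.InjOn γ (Set.Icc 0 1) ∧ γ 0 = 0 ∧ γ 1 = 1 ∧
      (∀ t ∈ Set.Icc (0 : ℝ) 1, (γ t).re ∈ Set.Icc (0 : ℝ) 1 ∧ (γ t).im ∈ Set.Icc (0 : ℝ) 1) ∧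
      0 < MeasureTheory.volume (γ '' Set.Icc (0 : ℝ) 1)) →
    ∃ D : DobrushinDomain, D.pt 0 = 0 ∧ D.pt 1 = -2 * Complex.I ∧
      (∀ ε : ℝ, 0 < ε → 0 < MeasureTheory.volume (D.boundary '' Set.Ioo (D.mark 0) (D.mark 0 + ε)) ∧
        0 < MeasureTheory.volume (D.boundary '' Set.Ioo (D.mark 0 - ε) (D.mark 0))) ∧
      (∃ r : ℝ, 0 < r ∧ ∀ w : ℂ, ‖w‖ < r → w.im < 0 → w ∈ D.carrier) ∧
      (∀ r : ℝ, 0 < r → ∃ x : ℝ, 0 < x ∧ x < r ∧ (x : ℂ) ∉ D.carrier ∧ (-(x : ℂ)) ∉ D.carrier) ∧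
      (∀ r : ℝ, 0 < r → ∃ w : ℂ, ‖w‖ < r ∧ 0 < w.im ∧ w ∉ D.carrier) ∧
      (∀ t : ℝ, 0 < t → t < 2 → -((t : ℂ) * Complex.I) ∈ D.carrier) := by
  rintro ⟨γ, hc, hi, h0, h1, hmem, hvol⟩
  have h : IsOsgoodArc γ := ⟨hc, hi, h0, h1, hmem, hvol⟩
  refine ⟨fatDomain h, fatDomain_pt_zero h, fatDomain_pt_one h, fun ε hε => ?_,
    ⟨1 / 2, one_half_pos, fun w hw hw' => mem_carrier_of_norm_lt h hw hw'⟩, fun r hr => ?_,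
    fun r hr => ?_, fun t ht0 ht2 => neg_mul_I_mem_carrier h ht0 ht2⟩
  · rw [fatDomain_mark_zero, zero_add, zero_sub, fatDomain_boundary]
    exact ⟨volume_image_Ioo_pos h hε, volume_image_Ioo_neg_pos h hε⟩
  · obtain ⟨n, hn⟩ := exists_pow_lt_of_lt_one hr (by norm_num : (1 / 2 : ℝ) < 1)
    rw [one_div, inv_pow] at hn
    obtain ⟨h1, h2⟩ := ofReal_not_mem_carrier h n
    have hlt := mul_lt_mul_of_pos_left (by norm_num : (5 / 8 : ℝ) < 1)
      (inv_pos.2 (pow_pos two_pos n) : (0 : ℝ) < ((2 : ℝ) ^ n)⁻¹)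
    exact ⟨((2 : ℝ) ^ n)⁻¹ * (5 / 8), by positivity, by linarith, h1, h2⟩
  · obtain ⟨n, hn⟩ := exists_pow_lt_of_lt_one (half_pos hr) (by norm_num : (1 / 2 : ℝ) < 1)
    rw [one_div, inv_pow] at hn
    obtain ⟨w, hw, hw', hwD⟩ := exists_not_mem_carrier_im_pos h n
    exact ⟨w, by linarith, hw', hwD⟩

end Summit.CriticalPhenomena.CardyFormulaZ2.Theorems.CardyRotToConfR2SymmetryUpgrade

end
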